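import Literature.MathematicalPhysics.QuantumLattice.HubbardThermalNoChargeDensityWaveLRO
import HarnessLib

/-!
# Kubo–Kishi 1990, Theorem 1 / Remark 1: no magnetic (`S^z`) long-range order at any temperature
# in the ATTRACTIVE Hubbard model, at any filling, in every dimension

Topic `MathematicalPhysics/QuantumLattice` (family `hubbard`); sibling of
`HubbardThermalNoChargeDensityWaveLRO.lean` (the half-filled REPULSIVE statements of Kubo–Kishi's
Remark 3). K. Kubo, T. Kishi, *Rigorous bounds on the susceptibilities of the Hubbard model*,
Phys. Rev. B **41** (1990) 4866–4868 [KuboKishi1990] (reprinted in A. Montorsi (ed.), *The Hubbard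
Model*, World Scientific 1992; read there, reprint pp. 120–123 = PRB pp. 4866–4867).

Kubo–Kishi's Theorem 1: for the ATTRACTIVE model (`U < 0`, equal chemical potentials for both spins,
any filling, any finite lattice, any real symmetric hopping) the static spin susceptibility obeys
`χ_q = β(S^z_q, S^z_{-q}) ≤ (4|U|)⁻¹` at EVERY wave vector `q` (eq. (3)); Remark 1: by the Falk–Bruch
inequality this bounds the equal-time correlation `⟨S^z_q S^z_{-q}⟩` (eq. (4)); and (abstract, and
p. 4866) "the present result implies that the susceptibilities never diverge in the above-mentioned
circumstances and also the absence of corresponding long-range order" / "obtained bounds … lead to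
the conclusion that no phase transition leading to corresponding long-range order occurs" — here:
no longitudinal magnetic order of the attractive model at any `T > 0`, uniform (`q = 0`) or
staggered (`q = (π,…,π)`), in every dimension `d ≥ 1` (not a Mermin–Wagner statement; the ceiling is
interaction-dependent, `∝ 1/(β|U|) + √(|t|/|U|)`).

The tree PROVES the quantitative inputs in `HubbardKuboKishiFSum.lean` (from the Gaussian-domination
theorem `kuboKishi_spin_gaussianDomination_holds` and the Falk–Bruch transfer):
`kuboKishi_spin_sq_le_explicit` — `⟨M_a²⟩_β ≤ B/(β|U|) + ½ √((B/|U|)·|t| Σ_{x∼y} (a_x - a_y)²)`,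
`M_a = Σ_x a_x (n_{x↑} - n_{x↓}) = 2 Σ_x a_x S^z_x`, `B = Σ a_x²` — and its staggered specialisation
`kuboKishi_staggered_spin_sq_le`. This file states the CONCLUSIONS in the tree's long-range-order
vocabulary (`HasTorusLRO` of `LatticeTori.lean`, `HasStaggeredEvenTorusLRO` of `HeisenbergOrder.lean`)
for the torus family of thermal `S^z` two-point functions, and proves them:

* `spinDev x = n_{x↑} - n_{x↓} = 2 S^z_x` (Kubo–Kishi eq. (2)), `spinDensityField a = Σ_x a_x • spinDev x`
  (`rfl`), and `thermalSpinZCorr β t U μ L x y = Re ⟨(n_{x↑}-n_{x↓})(n_{y↑}-n_{y↓})⟩_{β,L} = 4 Re ⟨S^z_x S^z_y⟩_{β,L}`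
  for `hubbardTorusWith d L t U μ`, as an `L`-indexed torus family;
* `re_gibbsState_spinDensityField_mul` — bilinearity `Re ⟨M_a M_b⟩ = Σ_{z,w} a_z b_w Re ⟨σ_z σ_w⟩`;
* `sum_thermalSpinZCorr_eq` / `staggeredSum_thermalSpinZCorr_eq` — the plain and the staggered double
  sums of the family ARE `Re ⟨M_1²⟩` and `Re ⟨M_ε²⟩` (`ε = torusStagger`);
* `sum_thermalSpinZCorr_le` — `U < 0`, any `μ`, EVERY side `L ≥ 1`:
  `0 ≤ Σ_{x,y} Re ⟨σ_x σ_y⟩_{β,L} ≤ L^d/(β|U|)` (the uniform field `a ≡ 1` commutes with the hopping: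
  the bond sum vanishes — Kubo–Kishi (3) at `q = 0`);
  `staggeredSum_thermalSpinZCorr_le` — `U < 0`, any `μ`, every EVEN side:
  `0 ≤ Σ_{x,y} (-1)^{x+y} Re ⟨σ_x σ_y⟩_{β,L} ≤ (1/(β|U|) + ½√(8d|t|/|U|)) L^d` (Kubo–Kishi (4) at
  `q = (π,…,π)`, degree `2d`);
* `not_hasTorusLRO_of_abs_sum_le` — a torus family with `O(L^d)` double sums at every side has no
  long-range order (the `L^{-2d}`-normalised sums tend to `0`);
* `hubbard_attractive_thermal_not_uniformSpinZLRO`, `hubbard_attractive_thermal_not_staggeredSpinZLRO`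
  — **Kubo–Kishi's Theorem 1 / Remark 1 as absence of order**: for every `d ≥ 1`, every `t`, every
  `U < 0`, every `μ` and every `0 < β < ∞`, `¬ HasTorusLRO (thermalSpinZCorr β t U μ)` and
  `¬ HasStaggeredEvenTorusLRO (thermalSpinZCorr β t U μ)`.

Scope (honest): longitudinal (`S^z`) two-point function of the attractive model, `U < 0`, `T > 0`, the
two wave vectors `q = 0` and `q = (π,…,π)` that the tree's torus LRO notions express (Kubo–Kishi's (3)
holds at every `q`); no decay rate; nothing on the repulsive model away from half filling. Theorems and
two definitions (observables); no named fact, no statement of the tree is changed.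
HONEST FRAMING (cell pub-hubbard): ladder R1–R4 with certified numbers; no claim on H/H₀.

References: [KuboKishi1990] Theorem 1, eqs. (2)–(4), (10), Remark 1, abstract; H. Falk, L. W. Bruch,
Phys. Rev. 180 (1969) 442; [DLS1978] §1 eq. (4); [FriedliVelenik2017] §3.7.2 Definition 3.27.
-/

noncomputable section

namespace Literature.MathematicalPhysics.QuantumLattice

open Matrix Finset Filter Topology HubbardWave0 Literature.Probability.LatticeModels
open scoped ComplexOrder

/-! ### A torus family with `O(L^d)` double sums has no long-range order -/

section Uniform

variable {d : ℕ}

/-- If the double sums of a torus family are `O(L^d)` at every side, `|Σ_{x,y ∈ (ℤ/Lℤ)^d} G_L(x,y)| ≤ C L^d`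
(`L ≥ 1`), then the `L^{-2d}`-normalised sums are `O(L^{-d}) → 0` (`d ≥ 1`), so their `liminf` is `0`
and `¬ HasTorusLRO G` (unfolded by `hasTorusLRO_iff_holds`, index `L + 1`). Friedli–Velenik (2017)
§3.7.2, Definition 3.27; Kubo–Kishi (1990), abstract ("absence of corresponding long-range order").
[cite: KuboKishi1990, Theorem 1 and abstract] -/
theorem not_hasTorusLRO_of_abs_sum_le (hd : d ≠ 0)
    {G : (L : ℕ) → TorusSite d L → TorusSite d L → ℝ} {C : ℝ}
    (hG : ∀ (L : ℕ) [NeZero L],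
      |∑ x : TorusSite d L, ∑ y : TorusSite d L, G L x y| ≤ C * (L : ℝ) ^ d) :
    ¬ HasTorusLRO G := by
  classical
  rw [hasTorusLRO_iff_holds]
  set a : ℕ → ℝ := fun L =>
    (∑ x : TorusSite d (L + 1), ∑ y : TorusSite d (L + 1), G (L + 1) x y) /
      ((L + 1 : ℕ) : ℝ) ^ (2 * d) with ha
  have hL : Tendsto (fun L : ℕ => ((L + 1 : ℕ) : ℝ)) atTop atTop :=
    tendsto_natCast_atTop_atTop.comp (tendsto_add_atTop_nat 1)
  have h2 : Tendsto (fun L : ℕ => C / ((L + 1 : ℕ) : ℝ) ^ d) atTop (𝓝 0) :=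
    tendsto_const_nhds.div_atTop ((tendsto_pow_atTop hd).comp hL)
  have hT : Tendsto a atTop (𝓝 0) := by
    refine squeeze_zero_norm (fun L => ?_) h2
    have hL0 : (0 : ℝ) < ((L + 1 : ℕ) : ℝ) := by positivity
    have hLd : (0 : ℝ) < ((L + 1 : ℕ) : ℝ) ^ d := pow_pos hL0 d
    rw [Real.norm_eq_abs, ha]
    dsimp only
    rw [abs_div, abs_of_nonneg (pow_nonneg hL0.le _), two_mul d, pow_add]
    calc |∑ x : TorusSite d (L + 1), ∑ y : TorusSite d (L + 1), G (L + 1) x y| /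
          (((L + 1 : ℕ) : ℝ) ^ d * ((L + 1 : ℕ) : ℝ) ^ d)
        ≤ C * ((L + 1 : ℕ) : ℝ) ^ d / (((L + 1 : ℕ) : ℝ) ^ d * ((L + 1 : ℕ) : ℝ) ^ d) :=
          div_le_div_of_nonneg_right (hG (L + 1)) (mul_pos hLd hLd).le
      _ = C / ((L + 1 : ℕ) : ℝ) ^ d := by rw [mul_div_mul_right _ _ hLd.ne']
  intro hLRO
  change 0 < liminf a atTop at hLRO
  rw [hT.liminf_eq] at hLRO
  exact lt_irrefl 0 hLRO

end Uniform

/-! ### The on-site spin polarisation and bilinearity of `⟨M_a M_b⟩` -/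

section Fields

variable {Λ : Type*} [LinearOrder Λ] [Fintype Λ]

/-- The on-site spin polarisation `σ_x = n_{x↑} - n_{x↓} = 2 S^z_x` (Kubo–Kishi's `S^z_α = (n_{α↑} - n_{α↓})/2`,
eq. (2)); the longitudinal spin field is `M_a = Σ_x a_x σ_x` (`spinDensityField_eq_sum_smul_spinDev`).
[cite: KuboKishi1990, eq. (2)] -/
def spinDev (x : Λ) : Matrix (Finset (Orb Λ)) (Finset (Orb Λ)) ℂ :=
  numberOp x 0 - numberOp x 1

/-- `M_a = Σ_x a_x σ_x` (definitional). Kubo–Kishi (1990), eq. (7). [cite: KuboKishi1990, eq. (7)] -/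
theorem spinDensityField_eq_sum_smul_spinDev (a : Λ → ℝ) :
    spinDensityField a = ∑ x : Λ, (a x : ℂ) • spinDev x :=
  rfl

/-- `σ_x = 2 S^z_x` is Hermitian. Kubo–Kishi (1990), eq. (2). [cite: KuboKishi1990, eq. (2)] -/
theorem isHermitian_spinDev (x : Λ) : (spinDev x).IsHermitian := by
  have hn : ∀ τ : Fin 2, (numberOp x τ)ᴴ = numberOp x τ := fun τ =>
    (numberAt_isHermitian (orb x τ)).eq
  unfold spinDev Matrix.IsHermitian
  rw [conjTranspose_sub, hn, hn]

/-- `Re ⟨M_a M_b⟩_β = Σ_{z,w} a_z b_w Re ⟨σ_z σ_w⟩_β` for the spin fields `M_a = Σ_z a_z σ_z` and any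
Hamiltonian (bilinearity of the Gibbs state; stated for an arbitrary `DecidableEq` instance on the
orbital sets so that it rewrites in every lattice context). Kubo–Kishi (1990), eq. (4) with `S^z_q`
the Fourier transform of `S^z_α`. [cite: KuboKishi1990, Remark 1, eq. (4)] -/
theorem re_gibbsState_spinDensityField_mul [DecidableEq (Finset (Orb Λ))] (β : ℝ)
    (H : Matrix (Finset (Orb Λ)) (Finset (Orb Λ)) ℂ) (a b : Λ → ℝ) :
    (gibbsState β H (spinDensityField a * spinDensityField b)).re =
      ∑ z : Λ, ∑ w : Λ, a z * b w * (gibbsState β H (spinDev z * spinDev w)).re := by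
  rw [spinDensityField_eq_sum_smul_spinDev, spinDensityField_eq_sum_smul_spinDev,
    Finset.sum_mul_sum, map_sum, Complex.re_sum]
  refine sum_congr rfl fun z _ => ?_
  rw [map_sum, Complex.re_sum]
  refine sum_congr rfl fun w _ => ?_
  rw [Matrix.smul_mul, Matrix.mul_smul, smul_smul, map_smul, smul_eq_mul, ← Complex.ofReal_mul,
    Complex.re_ofReal_mul]

/-- `Re ⟨M_a M_a⟩_β ≥ 0` for a Hermitian Hamiltonian (`M_a M_a = M_aᴴ M_a ≥ 0` and the Gibbs state is
positive). [folklore] -/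
private theorem re_gibbsState_spinDensityField_sq_nonneg [DecidableEq (Finset (Orb Λ))] (β : ℝ)
    {H : Matrix (Finset (Orb Λ)) (Finset (Orb Λ)) ℂ} (hH : H.IsHermitian) (a : Λ → ℝ) :
    0 ≤ (gibbsState β H (spinDensityField a * spinDensityField a)).re := by
  have hpsd : (spinDensityField a * spinDensityField a).PosSemidef := by
    have h := posSemidef_conjTranspose_mul_self (spinDensityField a)
    rwa [(isHermitian_spinDensityField a).eq] at h
  exact (Complex.nonneg_iff.mp (gibbsState_nonneg_of_posSemidef β hH hpsd)).1

end Fields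

/-! ### The thermal longitudinal spin two-point function on the torus -/

section Torus

variable {d L : ℕ}

/-- The thermal longitudinal spin two-point function of the grand-canonical Hubbard model on the torus
`(ℤ/Lℤ)^d`, `G_L(x, y) = Re ⟨σ_x σ_y⟩_{β, L} = 4 Re ⟨S^z_x S^z_y⟩_{β, L}`, `σ_x = n_{x↑} - n_{x↓}` (Gibbs state
of `hubbardTorusWith d L t U μ`; orbitals via `FermionTorus.ofTorusSite`), as an `L`-indexed family in the
format of `HasTorusLRO` / `HasStaggeredEvenTorusLRO`. **Junk value** `0` at `L = 0`.
Kubo–Kishi (1990), Remark 1, eq. (4). [cite: KuboKishi1990, Remark 1, eq. (4)] -/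
def thermalSpinZCorr (β t U μ : ℝ) : (L : ℕ) → TorusSite d L → TorusSite d L → ℝ
  | 0, _, _ => 0
  | L + 1, x, y =>
    ((hubbardTorusWith d (L + 1) t U μ).thermalCorr β
      (spinDev (FermionTorus.ofTorusSite x)) (spinDev (FermionTorus.ofTorusSite y))).re

/-- `thermalSpinZCorr` at positive side, unfolded. Kubo–Kishi (1990), Remark 1, eq. (4).
[cite: KuboKishi1990, Remark 1, eq. (4)] -/
@[simp] theorem thermalSpinZCorr_succ (β t U μ : ℝ) (L : ℕ) (x y : TorusSite d (L + 1)) :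
    thermalSpinZCorr β t U μ (L + 1) x y =
      ((hubbardTorusWith d (L + 1) t U μ).thermalCorr β
        (spinDev (FermionTorus.ofTorusSite x)) (spinDev (FermionTorus.ofTorusSite y))).re :=
  rfl

/-- The bipartite sign of the fermionic torus at a canonical representative is the Néel sign of
`HasStaggeredEvenTorusLRO` (`equivTorusSite.symm = ofTorusSite`; private copy of the sibling file's
lemma). [folklore] -/
private theorem cast_torusStagger_symm_apply' [NeZero L] (x : TorusSite d L) :
    ((torusStagger ((FermionTorus.equivTorusSite (d := d) (L := L)).symm x) : ℤ) : ℝ) =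
      (-1 : ℝ) ^ (∑ i, (x i).val) := by
  -- `torusStagger` elaborates to `Int.instUnitsPow` (definitionally the monoid power)
  have h : torusStagger ((FermionTorus.equivTorusSite (d := d) (L := L)).symm x) =
      NPow.npow (∑ i, (x i).val) (-1 : ℤˣ) := rfl
  rw [h, npow_eq_pow, Units.val_pow_eq_pow_val, Units.val_neg, Units.val_one, Int.cast_pow,
    Int.cast_neg, Int.cast_one]

/-- **The double sum is the uniform spin fluctuation**: for `L ≥ 1`,
`Σ_{x,y ∈ (ℤ/Lℤ)^d} Re ⟨σ_x σ_y⟩_{β,L} = Re ⟨M_1 M_1⟩_{β,L}`, `M_1 = Σ_z σ_z = 2 S^z_tot` (`a ≡ 1`).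
Kubo–Kishi (1990), eq. (4) at `q = 0`. [cite: KuboKishi1990, Remark 1, eq. (4)] -/
theorem sum_thermalSpinZCorr_eq (β t U μ : ℝ) (L : ℕ) [NeZero L] :
    (∑ x : TorusSite d L, ∑ y : TorusSite d L, thermalSpinZCorr β t U μ L x y) =
      (gibbsState β (hubbardTorusWith d L t U μ)
        (spinDensityField (fun _ : FermionTorus d L => (1 : ℝ)) *
          spinDensityField fun _ => (1 : ℝ))).re := by
  obtain ⟨n, rfl⟩ : ∃ n, L = n + 1 := Nat.exists_eq_succ_of_ne_zero (NeZero.ne L)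
  rw [re_gibbsState_spinDensityField_mul]
  refine Fintype.sum_equiv (FermionTorus.equivTorusSite (d := d) (L := n + 1)).symm _ _ fun x => ?_
  refine Fintype.sum_equiv (FermionTorus.equivTorusSite (d := d) (L := n + 1)).symm _ _ fun y => ?_
  rw [one_mul, one_mul, thermalSpinZCorr_succ]
  rfl

/-- **The staggered double sum is the staggered spin fluctuation**: for `L ≥ 1`,
`Σ_{x,y ∈ (ℤ/Lℤ)^d} (-1)^x (-1)^y Re ⟨σ_x σ_y⟩_{β,L} = Re ⟨M_ε M_ε⟩_{β,L}`, `M_ε = Σ_z ε_z σ_z`,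
`ε = torusStagger`. Kubo–Kishi (1990), eq. (4) at `q = (π,…,π)`. [cite: KuboKishi1990, Remark 1, eq. (4)] -/
theorem staggeredSum_thermalSpinZCorr_eq (β t U μ : ℝ) (L : ℕ) [NeZero L] :
    (∑ x : TorusSite d L, ∑ y : TorusSite d L,
        (-1 : ℝ) ^ (∑ i, (x i).val) * (-1) ^ (∑ i, (y i).val) * thermalSpinZCorr β t U μ L x y) =
      (gibbsState β (hubbardTorusWith d L t U μ)
        (spinDensityField (fun z => ((torusStagger z : ℤ) : ℝ)) *
          spinDensityField fun z => ((torusStagger z : ℤ) : ℝ))).re := by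
  obtain ⟨n, rfl⟩ : ∃ n, L = n + 1 := Nat.exists_eq_succ_of_ne_zero (NeZero.ne L)
  rw [re_gibbsState_spinDensityField_mul]
  refine Fintype.sum_equiv (FermionTorus.equivTorusSite (d := d) (L := n + 1)).symm _ _ fun x => ?_
  refine Fintype.sum_equiv (FermionTorus.equivTorusSite (d := d) (L := n + 1)).symm _ _ fun y => ?_
  rw [cast_torusStagger_symm_apply', cast_torusStagger_symm_apply', thermalSpinZCorr_succ]
  rfl

/-- Every site of the torus `(ℤ/Lℤ)^d` has at most `2d` neighbours (private copy of
`card_filter_fermionTorusGraph_adj_le` of `HubbardLSMFillingProofs`, not imported here). [folklore] -/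
private theorem card_filter_fermionTorusGraph_adj_le'' [NeZero L] (u : FermionTorus d L) :
    (Finset.univ.filter fun v => (fermionTorusGraph d L).Adj u v).card ≤ 2 * d := by
  classical
  set S₁ : Finset (FermionTorus d L) := Finset.univ.image fun i : Fin d =>
    FermionTorus.ofTorusSite (FermionTorus.toTorusSite u + Pi.single i (1 : ZMod L))
  set S₂ : Finset (FermionTorus d L) := Finset.univ.image fun i : Fin d =>
    FermionTorus.ofTorusSite (FermionTorus.toTorusSite u - Pi.single i (1 : ZMod L))
  have hsub : (Finset.univ.filter fun v => (fermionTorusGraph d L).Adj u v) ⊆ S₁ ∪ S₂ := by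
    intro v hv
    rw [Finset.mem_filter] at hv
    obtain ⟨-, hv⟩ := hv
    rw [fermionTorusGraph_adj, torusGraph_adj_iff] at hv
    obtain ⟨-, ⟨i, hi⟩ | ⟨i, hi⟩⟩ := hv
    · refine Finset.mem_union_left _ (Finset.mem_image.2 ⟨i, Finset.mem_univ _, ?_⟩)
      rw [← hi, FermionTorus.ofTorusSite_toTorusSite]
    · refine Finset.mem_union_right _ (Finset.mem_image.2 ⟨i, Finset.mem_univ _, ?_⟩)
      rw [hi, add_sub_cancel_right, FermionTorus.ofTorusSite_toTorusSite]
  calc (Finset.univ.filter fun v => (fermionTorusGraph d L).Adj u v).card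
      ≤ (S₁ ∪ S₂).card := Finset.card_le_card hsub
    _ ≤ S₁.card + S₂.card := Finset.card_union_le _ _
    _ ≤ d + d := add_le_add (Finset.card_image_le.trans (by simp))
        (Finset.card_image_le.trans (by simp))
    _ = 2 * d := by ring

/-- The fermionic torus has `L^d` sites (private copy). [folklore] -/
private theorem card_fermionTorus''' : Fintype.card (FermionTorus d L) = L ^ d := by
  change Fintype.card (Fin d → Fin L) = L ^ d
  rw [Fintype.card_fun, Fintype.card_fin, Fintype.card_fin]

/-- **Uniform (`q = 0`) spin fluctuations of the attractive model are `O(L^d)` at every side**: for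
`U < 0`, any `μ`, `β > 0`, every `d` and every `L ≥ 1`,
`0 ≤ Σ_{x,y ∈ (ℤ/Lℤ)^d} Re ⟨σ_x σ_y⟩_{β,L} ≤ L^d/(β|U|)` — Kubo–Kishi's (3)/(10) with the uniform test
function `a ≡ 1` (`kuboKishi_spin_sq_le_explicit`; the bond sum `Σ_{x∼y}(a_x - a_y)²` vanishes because
`M_1 = 2S^z_tot` is conserved), no parity assumption on `L`.
[cite: KuboKishi1990, Theorem 1, eqs. (3), (10)] -/
theorem sum_thermalSpinZCorr_le (t μ : ℝ) {U β : ℝ} (hU : U < 0) (hβ : 0 < β) (L : ℕ) [NeZero L] :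
    0 ≤ ∑ x : TorusSite d L, ∑ y : TorusSite d L, thermalSpinZCorr β t U μ L x y ∧
    (∑ x : TorusSite d L, ∑ y : TorusSite d L, thermalSpinZCorr β t U μ L x y) ≤
      (L : ℝ) ^ d / |U| / β := by
  rw [sum_thermalSpinZCorr_eq]
  have hHG : hubbardTorusWith d L t U μ = hamiltonianWith (fermionTorusGraph d L) t U μ := rfl
  refine ⟨re_gibbsState_spinDensityField_sq_nonneg β
    (isHermitian_hamiltonianWith (fermionTorusGraph d L) t U μ) _, ?_⟩
  have hKK : (gibbsState β (hubbardTorusWith d L t U μ)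
      (spinDensityField (fun _ : FermionTorus d L => (1 : ℝ)) *
        spinDensityField fun _ => (1 : ℝ))).re ≤
      (∑ _x : FermionTorus d L, (1 : ℝ) ^ 2) / |U| / β +
        1 / 2 * Real.sqrt ((∑ _x : FermionTorus d L, (1 : ℝ) ^ 2) / |U| *
          (|t| * ∑ x : FermionTorus d L, ∑ y : FermionTorus d L,
            if (fermionTorusGraph d L).Adj x y then ((1 : ℝ) - 1) ^ 2 else 0)) := by
    rw [hHG]
    -- `convert`: structural versus order-derived `DecidableEq` instance on the orbitals
    convert kuboKishi_spin_sq_le_explicit (fermionTorusGraph d L)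
      kuboKishi_spin_gaussianDomination_holds (t := t) (μ := μ) hU hβ fun _ => (1 : ℝ)
  have hbond : (∑ x : FermionTorus d L, ∑ y : FermionTorus d L,
      if (fermionTorusGraph d L).Adj x y then ((1 : ℝ) - 1) ^ 2 else 0) = 0 :=
    Finset.sum_eq_zero fun x _ => Finset.sum_eq_zero fun y _ => by simp
  have hB : (∑ _x : FermionTorus d L, (1 : ℝ) ^ 2) = (L : ℝ) ^ d := by
    rw [Finset.sum_const, Finset.card_univ, card_fermionTorus''', nsmul_eq_mul, one_pow, mul_one,
      Nat.cast_pow]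
  rw [hbond, hB, mul_zero, mul_zero, Real.sqrt_zero, mul_zero, add_zero] at hKK
  exact hKK

/-- **Staggered (`q = (π,…,π)`) spin fluctuations of the attractive model are `O(L^d)` along the even
sides**: for `U < 0`, any `μ`, `β > 0`, every `d` and every EVEN side `L`,
`0 ≤ Σ_{x,y ∈ (ℤ/Lℤ)^d} (-1)^{x+y} Re ⟨σ_x σ_y⟩_{β,L} ≤ (1/(β|U|) + ½ √(4·(2d)·|t|/|U|)) · L^d`
(`kuboKishi_staggered_spin_sq_le` with `ε = torusStagger`, degree `2d`, `|Λ| = L^d`).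
[cite: KuboKishi1990, Remark 1, eq. (4)] -/
theorem staggeredSum_thermalSpinZCorr_le (t μ : ℝ) {U β : ℝ} (hU : U < 0) (hβ : 0 < β) (L : ℕ)
    [NeZero L] (hL : Even L) :
    0 ≤ ∑ x : TorusSite d L, ∑ y : TorusSite d L,
        (-1 : ℝ) ^ (∑ i, (x i).val) * (-1) ^ (∑ i, (y i).val) * thermalSpinZCorr β t U μ L x y ∧
    (∑ x : TorusSite d L, ∑ y : TorusSite d L,
        (-1 : ℝ) ^ (∑ i, (x i).val) * (-1) ^ (∑ i, (y i).val) * thermalSpinZCorr β t U μ L x y) ≤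
      (1 / |U| / β + 1 / 2 * Real.sqrt (4 * (2 * d : ℕ) * |t| / |U|)) * (L : ℝ) ^ d := by
  rw [staggeredSum_thermalSpinZCorr_eq]
  have hHG : hubbardTorusWith d L t U μ = hamiltonianWith (fermionTorusGraph d L) t U μ := rfl
  refine ⟨re_gibbsState_spinDensityField_sq_nonneg β
    (isHermitian_hamiltonianWith (fermionTorusGraph d L) t U μ) _, ?_⟩
  have hKK : (gibbsState β (hubbardTorusWith d L t U μ)
      (spinDensityField (fun z => ((torusStagger z : ℤ) : ℝ)) *
        spinDensityField fun z => ((torusStagger z : ℤ) : ℝ))).re ≤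
      (Fintype.card (FermionTorus d L) : ℝ) / |U| / β +
        1 / 2 * Real.sqrt ((Fintype.card (FermionTorus d L) : ℝ) / |U| *
          (|t| * (4 * (2 * d : ℕ) * Fintype.card (FermionTorus d L)))) := by
    rw [hHG]
    convert kuboKishi_staggered_spin_sq_le (fermionTorusGraph d L)
      kuboKishi_spin_gaussianDomination_holds torusStagger
      (fun _ _ h => torusStagger_eq_neg_of_adj_holds hL h)
      (fun x => card_filter_fermionTorusGraph_adj_le'' x) (t := t) (μ := μ) hU hβ
  refine hKK.trans (le_of_eq ?_)
  rw [card_fermionTorus''', Nat.cast_pow]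
  set N : ℝ := (L : ℝ) ^ d with hNdef
  have hN0 : 0 ≤ N := pow_nonneg (Nat.cast_nonneg _) d
  have hin : N / |U| * (|t| * (4 * ((2 * d : ℕ) : ℝ) * N)) =
      4 * ((2 * d : ℕ) : ℝ) * |t| / |U| * N ^ 2 := by
    ring
  rw [hin, Real.sqrt_mul' _ (sq_nonneg N), Real.sqrt_sq hN0]
  ring

/-- **Kubo–Kishi 1990, Theorem 1: no ferromagnetic (`q = 0`, longitudinal) long-range order at any
temperature in the attractive Hubbard model, any filling, every dimension.** For every `d ≥ 1`, every
hopping `t`, every `U < 0`, every chemical potential `μ` and every `0 < β < ∞`,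
`¬ HasTorusLRO (thermalSpinZCorr β t U μ)` for `hubbardTorusWith d L t U μ` — the normalised uniform
spin structure factor is `≤ L^{-d}/(β|U|) → 0` (`sum_thermalSpinZCorr_le`). "The present result implies
that the susceptibilities never diverge … and also the absence of corresponding long-range order."
[cite: KuboKishi1990, Theorem 1, eq. (3) and abstract (PRB 41, p. 4866)] -/
theorem hubbard_attractive_thermal_not_uniformSpinZLRO (hd : d ≠ 0) (t μ : ℝ) {U β : ℝ}
    (hU : U < 0) (hβ : 0 < β) :
    ¬ HasTorusLRO (thermalSpinZCorr (d := d) β t U μ) :=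
  not_hasTorusLRO_of_abs_sum_le hd (C := 1 / |U| / β) fun L _ => by
    obtain ⟨h0, hle⟩ := sum_thermalSpinZCorr_le (d := d) t μ hU hβ L
    rw [abs_of_nonneg h0]
    refine hle.trans (le_of_eq ?_)
    ring

/-- **Kubo–Kishi 1990, Theorem 1 / Remark 1: no spin-density-wave (`q = (π,…,π)`, longitudinal)
long-range order at any temperature in the attractive Hubbard model, any filling, every dimension.**
For every `d ≥ 1`, `t`, `U < 0`, `μ` and `0 < β < ∞`,
`¬ HasStaggeredEvenTorusLRO (thermalSpinZCorr β t U μ)` — the normalised staggered spin structure factor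
along the even tori is `≤ (1/(β|U|) + ½√(8d|t|/|U|)) L^{-d} → 0` (`staggeredSum_thermalSpinZCorr_le`).
An interaction-dependent, dimension-independent exclusion (Gaussian domination in spin space +
Falk–Bruch). [cite: KuboKishi1990, Theorem 1, Remark 1 eq. (4), abstract (PRB 41, p. 4866)] -/
theorem hubbard_attractive_thermal_not_staggeredSpinZLRO (hd : d ≠ 0) (t μ : ℝ) {U β : ℝ}
    (hU : U < 0) (hβ : 0 < β) :
    ¬ HasStaggeredEvenTorusLRO (thermalSpinZCorr (d := d) β t U μ) :=
  not_hasStaggeredEvenTorusLRO_of_abs_staggeredSum_le hd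
    (C := 1 / |U| / β + 1 / 2 * Real.sqrt (4 * (2 * d : ℕ) * |t| / |U|)) fun k => by
    obtain ⟨h0, hle⟩ :=
      staggeredSum_thermalSpinZCorr_le (d := d) t μ hU hβ (2 * k + 2) ⟨k + 1, by ring⟩
    rwa [abs_of_nonneg h0]

end Torus

end Literature.MathematicalPhysics.QuantumLattice
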